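import Summits.ValiantsHypothesis.ValiantsHypothesis.Theorems.LacunarySymmetroidMatrixDescartesCensusAtomM6K5EB80
import Summits.ValiantsHypothesis.ValiantsHypothesis.Theorems.LacunarySymmetroidMatrixDescartesCensusRowLawM6

/-!
# `MatrixDescartes` census — THE `m = 6` ROW LAW, second period: `ζ_sym(6,K) ≥ 160·⌊(K−1)/8⌋ + …` for EVERY `K ≥ 9` (slope `20` per letter)

HONEST FRAMING.  Experiment cell `val-V1-extremal`, width seat val-v1x-eng-9 g3 (`--supports stmt-ValiantsHypothesis-18050 --as helper`).
LOWER-bound / construction bookkeeping in census (CONJECTURE-A) currency, companion of `…CensusRowLawM6` (period `ENDBOTH75`, slope `18.75`):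
the same periodic block ladder with val-v1x-eng-2 g2's newer record `ENDBOTH80` (`(6,5) ≥ 80`, kernel `…CensusM6K5EB80`, block `AtomM6K5EB80` of
val-v1x-eng-8 g3's bank, end inertias bottom `(3,3)`, top `(1,5)`).  It proves NOTHING about the crux `Theses.LacunarySymmetroid.MatrixDescartes`
(stmt-ValiantsHypothesis-18050, an UPPER bound at fat formats), nothing about `DoorA26` / `DoorA34`, nothing about `VP ≠ VNP`; VP ≠ VNP is NOT proved.
No definitions, no `sorry`.

THE LAW.  The top inertia `(1,5)` of `ENDBOTH80` matches no other atom's bottom, so the period is the PAIR `E ▹ Eʳ` (`Reflect.block_reverse`: `Eʳ` has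
bottom `(1,5)`, top `(3,3)` = `E`'s bottom): `q` pairs = `8q + 1` letters, `160q` alternations, free end `(3,3)` (`chainD`).  Hence for every `K ≥ 9`
(`rowLaw`):  `¬ PosRootLawAt 6 K (160·⌊(K−1)/8⌋ + 6·((K−1) mod 8) − 1)` (graft residues), and with terminal blocks on the free `(3,3)` end the sharper
residues `+27` (`S-6-3`), `+53` (`QUADFLAG53ʳ`), `+80` (`E`), `+86`, `+106` (`QUADFLAG53ʳ ▹ QUADFLAG53`), `+128` (`ENDBOTH75ʳ ▹ QUADFLAG53`) (`row_r2 … row_r7`),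
linear form `ζ_sym(6,K) ≥ 20K − 34` (`rowLaw_linear`) — `K`-slope `20` per letter against `18.75` (`RowLawM6`) and `16` (`VSQ.gen_law`); still below the `P`-slope `21`
(`P(6,K) = 21K − 36`), so «P-tracking» at `m = 6` stays undecided by the cell's atoms.  Numeral samples: `(6,17) ≥ 320`, `(6,21) ≥ 400`, `(6,25) ≥ 480` (the cells `K ≤ 13` are eng-8 g3's `MixM6` block words).
Credits: row val-v1x-eng-2 g2 (ENDBOTH80); block kit + atom bank val-v1x-eng-8 g3; junction / ladder calculus val-sym-mdr-p1.
[folklore] throughout (inside the cited tree lemmas).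
-/

-- `Summit.ValiantsHypothesis.ValiantsHypothesis.…` repeats a component by the D-0017 layout
-- (single-conjunct summit), which the `dupNamespace` linter flags; the name is mandated.
set_option linter.dupNamespace false

namespace Summit.ValiantsHypothesis.ValiantsHypothesis.Theorems.LacunarySymmetroidMatrixDescartes.Census.Reflect.RowLawM6B

open Summit.ValiantsHypothesis.ValiantsHypothesis.Theorems.MatrixDescartes.Negative (PosRootLawAt)
open Summit.ValiantsHypothesis.ValiantsHypothesis.Theorems.LacunarySymmetroidMatrixDescartes.Census
open Summit.ValiantsHypothesis.ValiantsHypothesis.Theorems.LacunarySymmetroidMatrixDescartes.Census.Reflect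
open Summit.ValiantsHypothesis.ValiantsHypothesis.Theorems.LacunarySymmetroidMatrixDescartes.Census.Reflect.RowLawM4 (mono)
open scoped BigOperators Matrix

/-! ### The periodic ladder `(E ▹ Eʳ)^q` (`E = AtomM6K5EB80`) -/

/-- **Pair ladder**: `q + 1` copies of the pair `ENDBOTH80 ▹ ENDBOTH80ʳ` — a chain with `8q + 9` letters, `160(q+1)` alternations and top Sylvester
form of inertia `(3,3)`. [folklore] -/
theorem chainD (q : ℕ) : ∃ (d : Fin (8 * q + 8 + 1) → ℕ) (S : Fin (8 * q + 8 + 1) → Matrix (Fin 6) (Fin 6) ℝ)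
      (τ : Fin (160 * q + 160 + 1) → ℝ),
    StrictMono d ∧ (∀ h1 : 0 < 8 * q + 8 + 1, ∃ C : Matrix (Fin 6) (Fin 6) ℝ, C.det ≠ 0 ∧
      Cᵀ * S ⟨8 * q + 8 + 1 - 1, Nat.sub_lt h1 one_pos⟩ * C
        = Matrix.diagonal (![(1 : ℝ), (1 : ℝ), (1 : ℝ), (-1 : ℝ), (-1 : ℝ), (-1 : ℝ)] : Fin 6 → ℝ)) ∧
    (∀ l, (S l).IsSymm) ∧ StrictMono τ ∧ (∀ j, 0 < τ j) ∧ (∀ j, (∑ l, τ j ^ d l • S l).det ≠ 0) ∧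
    ∀ j : Fin (160 * q + 160), (∑ l, τ j.castSucc ^ d l • S l).det * (∑ l, τ j.succ ^ d l • S l).det < 0 := by
  induction q with
  | zero =>
    have h1 := Chain.chain_append (K₁ := 4) (K₂ := 4) (by norm_num) (Chain.chain_of_block AtomM6K5EB80.block)
      (block_reverse AtomM6K5EB80.block) (Equiv.refl (Fin 6)) (by intro i; fin_cases i <;> norm_num)
    exact Chain.certificateT_transport (by norm_num) (by norm_num) h1
  | succ q ih =>
    have h1 := Chain.chain_append (K₁ := 8 * q + 8) (K₂ := 4) (by norm_num) ih AtomM6K5EB80.block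
      (Equiv.refl (Fin 6)) (by intro i; fin_cases i <;> norm_num)
    have h2 := Chain.chain_append (K₁ := 8 * q + 12) (K₂ := 4) (by norm_num)
      (Chain.certificateT_transport (by ring) rfl h1) (block_reverse AtomM6K5EB80.block)
      (Equiv.refl (Fin 6)) (by intro i; fin_cases i <;> norm_num)
    exact Chain.certificateT_transport (by ring) (by ring) h2

/-! ### Rows -/

/-- **`K = 8q+9+i`: `ζ_sym(6, 8q+9+i) ≥ 160(q+1) + 6i`** (`i` grafted letters; `q = 0, i = 0` reads `(6,9) ≥ 160`, the tree's `endboth80_chain_row_6_9`).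
[folklore] -/
theorem row_graft (q i : ℕ) : ¬ PosRootLawAt 6 (8 * q + 9 + i) (160 * q + 159 + 6 * i) := by
  have h := not_posRootLawAt_of_certificateT_add (by omega) (chainD q) i
  rw [show 8 * q + 9 + i = 8 * q + 8 + 1 + i by ring, show 160 * q + 159 + 6 * i = 160 * q + 160 + i * 6 - 1 by omega]
  exact h

/-- **`K = 8q+13`: `ζ_sym(6, 8q+13) ≥ 160(q+1) + 80`** (one more `ENDBOTH80` on the free `(3,3)` end; `q = 0` reads `(6,13) ≥ 240` = val-v1x-eng-8 g3's
block word `MixM6.mix_6_13b`). [folklore] -/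
theorem row_r4 (q : ℕ) : ¬ PosRootLawAt 6 (8 * q + 13) (160 * q + 239) := by
  have h := Chain.not_posRootLawAt_of_certificateT (by omega)
    (Chain.chain_append (K₁ := 8 * q + 8) (K₂ := 4) (by norm_num) (chainD q) AtomM6K5EB80.block
      (Equiv.refl (Fin 6)) (by intro i; fin_cases i <;> norm_num))
  rw [show 8 * q + 13 = 8 * q + 8 + 4 + 1 by ring, show 160 * q + 239 = 160 * q + 160 + 80 - 1 by omega]
  exact h

/-- **`K = 8q+11`: `+27`** (terminal block = the `(6,3)` native `S-6-3` on the free `(3,3)` end). [folklore] -/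
theorem row_r2 (q : ℕ) : ¬ PosRootLawAt 6 (8 * q + 11) (160 * q + 186) := by
  have h := Chain.not_posRootLawAt_of_certificateT (by omega)
    (Chain.chain_append (K₁ := 8 * q + 8) (K₂ := 2) (by norm_num) (chainD q) AtomM6K3S63.block
      (Equiv.refl (Fin 6)) (by intro i; fin_cases i <;> norm_num))
  rw [show 8 * q + 11 = 8 * q + 8 + 2 + 1 by ring, show 160 * q + 186 = 160 * q + 160 + 27 - 1 by omega]
  exact h

/-- **`K = 8q+12`: `+53`** (terminal block = `QUADFLAG53` reversed). [folklore] -/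
theorem row_r3 (q : ℕ) : ¬ PosRootLawAt 6 (8 * q + 12) (160 * q + 212) := by
  have h := Chain.not_posRootLawAt_of_certificateT (by omega)
    (Chain.chain_append (K₁ := 8 * q + 8) (K₂ := 3) (by norm_num) (chainD q) (block_reverse AtomM6K4QF53.block)
      (Equiv.refl (Fin 6)) (by intro i; fin_cases i <;> norm_num))
  rw [show 8 * q + 12 = 8 * q + 8 + 3 + 1 by ring, show 160 * q + 212 = 160 * q + 160 + 53 - 1 by omega]
  exact h

/-- **`K = 8q+14`: `+86`** (one more `ENDBOTH80`, then one grafted letter). [folklore] -/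
theorem row_r5 (q : ℕ) : ¬ PosRootLawAt 6 (8 * q + 14) (160 * q + 245) := by
  have h := not_posRootLawAt_of_certificateT_add (by omega)
    (Chain.chain_append (K₁ := 8 * q + 8) (K₂ := 4) (by norm_num) (chainD q) AtomM6K5EB80.block
      (Equiv.refl (Fin 6)) (by intro i; fin_cases i <;> norm_num)) 1
  rw [show 8 * q + 14 = 8 * q + 8 + 4 + 1 + 1 by ring, show 160 * q + 245 = 160 * q + 160 + 80 + 1 * 6 - 1 by omega]
  exact h

/-- **`K = 8q+15`: `+106`** (`QUADFLAG53` reversed, then `QUADFLAG53`: free end `(3,3) → (4,2) → (3,3)`). [folklore] -/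
theorem row_r6 (q : ℕ) : ¬ PosRootLawAt 6 (8 * q + 15) (160 * q + 265) := by
  have h := Chain.not_posRootLawAt_of_certificateT (by omega)
    (Chain.chain_append (K₁ := 8 * q + 11) (K₂ := 3) (by norm_num)
      (Chain.chain_append (K₁ := 8 * q + 8) (K₂ := 3) (by norm_num) (chainD q) (block_reverse AtomM6K4QF53.block)
        (Equiv.refl (Fin 6)) (by intro i; fin_cases i <;> norm_num))
      AtomM6K4QF53.block (Equiv.refl (Fin 6)) (by intro i; fin_cases i <;> norm_num))
  rw [show 8 * q + 15 = 8 * q + 11 + 3 + 1 by ring, show 160 * q + 265 = 160 * q + 160 + 53 + 53 - 1 by omega]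
  exact h

/-- **`K = 8q+16`: `+128`** (`ENDBOTH75` reversed, then `QUADFLAG53`). [folklore] -/
theorem row_r7 (q : ℕ) : ¬ PosRootLawAt 6 (8 * q + 16) (160 * q + 287) := by
  have h := Chain.not_posRootLawAt_of_certificateT (by omega)
    (Chain.chain_append (K₁ := 8 * q + 12) (K₂ := 3) (by norm_num)
      (Chain.chain_append (K₁ := 8 * q + 8) (K₂ := 4) (by norm_num) (chainD q) (block_reverse AtomM6K5EB75.block)
        (Equiv.refl (Fin 6)) (by intro i; fin_cases i <;> norm_num))
      AtomM6K4QF53.block (Equiv.refl (Fin 6)) (by intro i; fin_cases i <;> norm_num))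
  rw [show 8 * q + 16 = 8 * q + 12 + 3 + 1 by ring, show 160 * q + 287 = 160 * q + 160 + 75 + 53 - 1 by omega]
  exact h

/-- **THE `m = 6` ROW LAW, period `ENDBOTH80` (closed form, graft residues).**  For every `K ≥ 9`:
`¬ PosRootLawAt 6 K (160·⌊(K−1)/8⌋ + 6·((K−1) mod 8) − 1)` — slope `20` per letter (the residue rows `row_r2 … row_r7` are sharper).  A LOWER bound in
census currency; nothing about the crux `MatrixDescartes`. [folklore] -/
theorem rowLaw (K : ℕ) (hK : 9 ≤ K) : ¬ PosRootLawAt 6 K (160 * ((K - 1) / 8) + 6 * ((K - 1) % 8) - 1) := by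
  obtain ⟨q, i, hi, rfl⟩ : ∃ q i, i < 8 ∧ K = 8 * q + 9 + i :=
    ⟨(K - 9) / 8, (K - 9) % 8, Nat.mod_lt _ (by norm_num), by omega⟩
  exact mono (row_graft q i) (by omega)

/-- **Linear form**: `ζ_sym(6,K) ≥ 20K − 34` for every `K ≥ 9` (`¬ PosRootLawAt 6 K (20K − 35)`; residues served by the terminal blocks above; worst
residues `(K−1) mod 8 ∈ {1, 5, 6}`), slope `20` against `RowLawM6.rowLaw_linear`'s `18K − 27` (better from `K = 9` on wherever both apply) and
`VSQ.gen_law`'s `16K − 31`. [folklore] -/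
theorem rowLaw_linear (K : ℕ) (hK : 9 ≤ K) : ¬ PosRootLawAt 6 K (20 * K - 35) := by
  obtain ⟨q, i, hi, rfl⟩ : ∃ q i, i < 8 ∧ K = 8 * q + 9 + i :=
    ⟨(K - 9) / 8, (K - 9) % 8, Nat.mod_lt _ (by norm_num), by omega⟩
  rcases hi_cases : i with _ | _ | _ | _ | _ | _ | _ | _ | i'
  · exact mono (row_graft q 0) (by omega)
  · exact mono (row_graft q 1) (by omega)
  · have h := row_r2 q
    exact mono h (by omega)
  · have h := row_r3 q
    exact mono h (by omega)
  · have h := row_r4 q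
    exact mono h (by omega)
  · have h := row_r5 q
    exact mono h (by omega)
  · have h := row_r6 q
    exact mono h (by omega)
  · have h := row_r7 q
    exact mono h (by omega)
  · omega

/-! ### Numeral cells (census format `(m,K) ≥ B + 1` reads `¬ PosRootLawAt m K B`) -/

/-- `ζ_sym(6,17) ≥ 320`. [folklore] -/
theorem row_6_17 : ¬ PosRootLawAt 6 17 319 := by
  have h := row_graft 1 0
  norm_num at h
  exact h

/-- `ζ_sym(6,21) ≥ 400`. [folklore] -/
theorem row_6_21 : ¬ PosRootLawAt 6 21 399 := row_r4 1

/-- `ζ_sym(6,25) ≥ 480`. [folklore] -/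
theorem row_6_25 : ¬ PosRootLawAt 6 25 479 := by
  have h := row_graft 2 0
  norm_num at h
  exact h

end Summit.ValiantsHypothesis.ValiantsHypothesis.Theorems.LacunarySymmetroidMatrixDescartes.Census.Reflect.RowLawM6B
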